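import Mathlib
import Summits.ResolutionOfSingularities.ResolutionOfSingularities.Theses.WildQuotients
import Summits.ResolutionOfSingularities.ResolutionOfSingularities.Theorems.WildQuotientsWildQuotientResolutionStubLocalDrop
import Summits.ResolutionOfSingularities.ResolutionOfSingularities.Theorems.WildQuotientsWildQuotientResolutionStubHasNormalSylowIff
import Summits.ResolutionOfSingularities.ResolutionOfSingularities.Theorems.WildQuotientsWildQuotientResolutionStubInertiaLe
import Summits.ResolutionOfSingularities.ResolutionOfSingularities.Theorems.WildQuotientsWildQuotientResolutionStubQuotientModelNormal
import Summits.ResolutionOfSingularities.ResolutionOfSingularities.Theorems.WildQuotientsWildQuotientResolutionStubBirational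
import Summits.ResolutionOfSingularities.ResolutionOfSingularities.Theorems.WildQuotientResolution.Negative.Faithful
import Literature.AlgebraicGeometry.Ramification.InertiaNormalSylow
import Literature.AlgebraicGeometry.Resolution.ResolutionOfSingularities
import Literature.AlgebraicGeometry.Resolution.ComponentGluing
import Literature.AlgebraicGeometry.Resolution.AlterationsProofs
import Literature.AlgebraicGeometry.Resolution.RegularLocalRingsNormal
import Literature.AlgebraicGeometry.Resolution.Blowups
import Literature.AlgebraicGeometry.Resolution.BlowupsExistence
import Literature.AlgebraicGeometry.Resolution.BlowupsEquivariant
import Literature.AlgebraicGeometry.Resolution.BlowupsIntegral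
import Literature.AlgebraicGeometry.Resolution.BlowupsProperProofs
import Literature.AlgebraicGeometry.Resolution.BlowupRegularPoints
import Literature.AlgebraicGeometry.Resolution.QuasiExcellentSchemes
import Summits.ResolutionOfSingularities.ResolutionOfSingularities.Theorems.WildQuotientsWildQuotientResolutionStubBorelCore
import Summits.ResolutionOfSingularities.ResolutionOfSingularities.Theorems.WildQuotientsWildQuotientResolutionStubFlagCore
import Summits.ResolutionOfSingularities.ResolutionOfSingularities.Theorems.WildQuotientsWildQuotientResolutionStubInertiaLocus
import Summits.ResolutionOfSingularities.ResolutionOfSingularities.Theorems.WildQuotientsWildQuotientResolutionStubPointBlowupStalkData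
import Summits.ResolutionOfSingularities.ResolutionOfSingularities.Theorems.WildQuotientsWildQuotientResolutionStubNpcCentre
import Summits.ResolutionOfSingularities.ResolutionOfSingularities.Theorems.WildQuotientsWildQuotientResolutionStubStableAffineCoverBlowup
import Summits.ResolutionOfSingularities.ResolutionOfSingularities.Theorems.WildQuotientsWildQuotientResolutionPhaseZeroDimOne
import Summits.ResolutionOfSingularities.ResolutionOfSingularities.Theorems.WildQuotientsWildQuotientResolutionGluedSplitDim

/-!
# Crux `WildQuotientResolution` (stmt-ResolutionOfSingularities-15640) — line `Sketch` (lead skeleton)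

`WildQuotientResolution_of : WildQuotientResolution` (route `ResolutionOfSingularities/WildQuotients`,
the DODGE at the de Jong/Gabber death point: every Galois-type quotient `X₁` of a REGULAR integral `X′`
by a finite group `G` in characteristic `p` has a resolution), assembled from stubs `stub_*` along the
crux-idea `p-closure-sylow-separation` (Phase 0 "Sylow separation": make every inertia group
*p-closed* — having a normal Sylow `p`-subgroup, the tree's `HasNormalSylow` = Abbes–Saito's (NpS) —
by `G`-equivariant blow-ups of the regular `X′` in regular `G`-stable centres, then hand the p-closed
case to the route's peeling + tame machinery).

Vocabulary (all in the tree): `Literature.AlgebraicGeometry.Ramification.inertiaSubgroup σ x`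
(AS2011 2.4: `g x = x` and `g` acts trivially on `κ(x)`), `…Ramification.HasNormalSylow p I`,
`Literature.AlgebraicGeometry.Resolution.Scheme.IsRegular / IsBirational / Scheme.HasResolution`.

* `stub_localDrop` (M) — THE ENGINE (card: `eigenvalue_eq_one_of_pow_char` + `closure_le_stabilizer`
  + `closure_fixing_lt`, merged): `I` finite acting `κ`-linearly on `W` (`char κ = p`),
  `Π = ⟨p-power-order elements of I⟩`; if `W^Π = 0` then for every `w ≠ 0` the subgroup generated by
  the p-power-order elements stabilising the LINE `κ w` is strictly smaller than `Π` (a p-power-order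
  `g` with `g w = c w` has `c^{pⁿ} = 1`, hence `c = 1`).
* `stub_hasNormalSylow_iff` (M) — `I` finite: `I` has a normal Sylow `p`-subgroup iff
  `⟨p-power-order elements of I⟩` is a `p`-group (the translation "p-closed ⇔ Π(x) is a p-group").
* `stub_inertia_le` (S) — inertia groups shrink along equivariant morphisms:
  `I_x(X♯) ≤ I_{π x}(X′)` (points outside the non-p-closed locus never re-enter it; subgroups of
  p-closed groups are p-closed, `HasNormalSylow.subgroup`).
* `stub_phaseZero` (XL — the card's Phase 0, stated CONDITIONAL on the three engine lemmas it
  consumes): for the crux data, a `G`-equivariant proper birational `π : X♯ → X′` with `X♯` regular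
  integral on which EVERY inertia group has a normal Sylow `p`-subgroup, covered by `G`-stable
  affine opens (so `X♯/G` is a scheme). Intended witness: blow up,
  in decreasing order of `|Π(x)|`, the reduced fixed locus of the p-closed residual `R(Π(x))`
  (regular when `R` is a `p′`-group; needs embedded regularisation when `R` is wild — the card's
  conceded gap in `dim X′ ≥ 5`), `stub_localDrop` giving the strict drop of `|Π|` over the centre.
* `stub_quotientModel` (L, classical; LANDED wave 2, p138081 + lemmas p137744; RESHAPE of cycle 2 — SGA1 V §1–2 through the tree's
  `Literature.AlgebraicGeometry.RelativeSpec.FiniteGroupQuotient*`, exactly as used by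
  `Theorems.galoisQuotientAlteration_of_deJong1997`): for FAITHFUL `ρ` and a Phase-0 model
  `(X♯, π, ρ♯)`, the quotient `Y₁ := X♯/G` exists (glued from the `G`-stable affine cover) with all
  the crux hypotheses for `(X♯, Y₁, q♯, G, ρ♯)` (integral, separated finite type over `k`, `q♯`
  finite surjective `G`-invariant, fibres = orbits, étale over a dense open — the action stays
  faithful on `X♯` because `π` is an epimorphism onto the reduced separated `X′`), the induced
  `r : Y₁ → X₁` (`q♯ ≫ r = π ≫ q`, categorical quotient) is proper, and over a dense open
  `W ⊆ X₁` (inside the étale locus of `q` and the isomorphism locus of `π`) `r` is finite, étale and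
  BIJECTIVE on points (fibres of `q` are single orbits; over `U` all inertia groups are trivial by
  rigidity of étale covers, so `X′_W → X′_W/G` is étale and `r` is étale by descent).
* `stub_birational_of_bijective` (M, classical; LANDED wave 2, p138276 + p137789 + p138056; RESHAPE of cycle 2 — the lemma (L) every proof of
  the crux AS TYPED needs, since the crux presents `X₁` by "fibres = orbits", not as `X′/G`): over a
  field, a morphism `r : Y₁ → X₁` of integral schemes, `X₁` of finite type and POSITIVE dimension,
  which over a dense open `W` is finite, étale and bijective on points, is birational. (False in
  dimension 0: `Spec L → Spec K`; false over a henselian trait; proof in positive dimension: reduce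
  to a regular curve `C ⊆ W`, take a primitive element `θ` of `𝒪(r⁻¹C)` with minimal polynomial
  `m`, and a closed point `c` of `𝔸¹_k` of prime degree `> deg r` in the image of `θ` — at a point
  `u` under `θ = c` the fibre polynomial `m_u` acquires a factor of the wrong degree, so the fibre
  splits: ≥ 2 points, contradiction unless `deg r = 1`.)
* `stub_pClosedWQ` (OPEN — the p-closed sub-problem, RESHAPE of cycle 2 replacing the transfer
  `stub_pClosedModel`): the crux verbatim PLUS "every inertia group of `ρ` has a normal Sylow
  `p`-subgroup". Implied by the summit; contains the route items `CyclicWildQuotient`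
  (stmt-15644, OPEN) and `TameQuotientResolution` (stmt-15645) — Lean certificates
  `Theorems.WildQuotientResolution.PClosedCase.cyclicWildQuotient_of_pClosedModel` /
  `tameQuotientResolution_of_pClosedModel` (p135875) for the cycle-1 form; it is the part of the
  crux the route's central-series peeling (KiralyLutkebohmert) + Bergh–Rydh tame end are built for,
  now typed WITHOUT any auxiliary model: the statement to PROMOTE. [difficulty: open-problem]

Composition: `WildQuotientResolution_of` = reduce to faithful `ρ` (`Negative.wqFaithful_iff`);
Phase 0 (`stub_phaseZero` fed with the three engine lemmas) gives the model `X♯`; dimension `0` is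
regular (`Scheme.IsRegular.of_topologicalKrullDim_le_zero`); otherwise `stub_quotientModel` builds
`Y₁ = X♯/G → X₁`, `stub_birational_of_bijective` makes it birational, `stub_pClosedWQ` resolves
`Y₁`, and `Scheme.HasResolution.of_isBirational` descends the resolution to `X₁`.

Every `sorry` of this file is inside a `stub_*`; v5 has THREE — the open sub-problems `stub_phaseZero`
(PhaseZeroModel) and `stub_pClosedWQNormal` (PClosedWQNormal), and the classical glue
`stub_quotientModelNormal` — LANDED wave 3 (p141366), so after wave 3 exactly TWO sorries remain: the open sub-problems.

Skeleton v4 (lead c2, 2026-08-17): `stub_phaseZero` RESHAPED — `hfaith : Function.Injective ρ` added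
(the v3 signature without it is refuted in `Theorems/WildQuotientsWildQuotientResolutionPhaseZeroFaithful.lean`,
`PhaseZeroFaithful.not_stub_phaseZero_v3`; the proved glue `GluedSplit` already carried it).

Skeleton v5 (lead c3, 2026-08-17) — **the registered stubs are now exactly the statements to file**:
* `stub_phaseZero` loses its three engine hypotheses (`hdrop`, `hsylow`, `hle` are THEOREMS —
  `stub_localDrop` p130134, `stub_hasNormalSylow_iff` p130224, `stub_inertia_le` p130271 — a filed
  PhaseZeroModel must not carry them) and keeps faithfulness (mandatory, p139843);
* `stub_pClosedWQ` is SHARPENED into `stub_pClosedWQNormal`: the p-closed sub-problem for `X₁` NORMAL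
  (all local rings integrally closed), of POSITIVE dimension, with `ρ` FAITHFUL — then `X₁` IS the
  quotient `X′/G` (the finite birational `X′/G → X₁` onto a normal scheme is an isomorphism), no longer
  "up to normalization"; all three additions are WLOG through the glue, so nothing is lost
  (`PClosedWQ ⇔ PClosedWQNormal`, Theorems file `…GluedSplitNormal`);
* the price is ONE new classical glue stub `stub_quotientModelNormal` = the landed `stub_quotientModel`
  PLUS normality of the glued quotient `X♯/G` of a normal `X♯` over a separated base (rings of
  invariants of integrally closed domains are integrally closed; normality is stalk-local) PLUS
  faithfulness of the lifted action `ρ♯` (already proved inside p138081, now exported).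
Composition unchanged in shape: faithful WLOG → Phase 0 → dim 0 apart → quotient model (normal) →
lemma (L) birational → dimension bookkeeping (`GluedSplitDim.topologicalKrullDim_eq_of_isBirational`)
→ `stub_pClosedWQNormal` on `X♯/G` → descend.

Skeleton v6 (lead c4, 2026-08-17) — **Phase 0 on SURFACES is one blow-up** (the "Borel argument";
leads c1–c3 expected an infinite tower of point blow-ups closed off by König + Abhyankar + ramification
theory of Krull valuations — unnecessary). Blow up the regular integral surface `X′` ONCE in the finite
reduced `G`-stable set `NPC(X′)` of points with non-p-closed inertia (closed points: generic inertia is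
trivial, inertia at DVR points is p-closed — both landed). At `x₁ ∈ X♯` over `x ∈ NPC` the blow-up makes
`𝔪_x 𝒪_{X♯,x₁} = (t)` invertible, so `φ : 𝔪_x/𝔪_x² → 𝔪_x𝒪_{X♯,x₁} ⊗ κ(x₁)` (a LINE) is
`I_{x₁}`-equivariant, `I_{x₁}` acting on the line by a character (inertia is residue-trivial), and
`ker φ` is a COMMON STABLE LINE of the 2-dimensional cotangent representation of `I_{x₁} ≤ I_x`: the
image of `I_{x₁}` in `GL₂` lies in a Borel (p-group ⋊ p′-torus) hence is p-closed, the kernel of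
`I_x → GL(𝔪/𝔪²)` is a p-group (tame automorphisms trivial on `κ ⊕ 𝔪/𝔪²` are trivial,
`Literature.RingTheory.CompleteLocalRings.ringEquiv_eq_one_of_cotangentTrivial_of_isUnit_orderOf` +
faithfulness on stalks), and a p-group-by-p-closed group is p-closed. v6 therefore SPLITS `stub_phaseZero`
by dimension — `dim X′ ≤ 2` assembled by the lead from FIVE CLASSICAL worker-sized stubs
(`stub_borelCore` = the algebra just described, `stub_isClosed_inertiaLocus`, `stub_npcCentre`,
`stub_pointBlowupStalkData`, `stub_stableAffineCoverBlowup`) and the tree's blow-up library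
(`exists_isBlowup`, `IsBlowup.liftAction`, `…isRegularLocalRing_stalk_of_finite`, `…isIntegral`,
`…isProper`, `…isBirational'`), `dim X′ ≥ 3` = `stub_phaseZeroHighDim` (open-adjacent, the honest
remaining Phase-0 problem). v6a registers the five classical stubs next to the v5 stubs (composition
unchanged); v6b wires the assembly into `stub_phaseZero`.

Skeleton v7 (lead c5, 2026-08-17) — **Phase 0 in dimension 3 is a theorem on paper** (`Lines/Sketch.md`
cycle 6: curve phase — point blow-ups regularise the NPC curves, ONE blow-up of their regular union
p-closes everything over it by the FLAG argument `ker φ̄ ⊂ N* ⊂ T*`; point phase — at most one child of a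
point blow-up keeps the same non-p-closed inertia, at the unique rational free point cut out by the
unique stable hyperplane, and an infinite constant-inertia chain is the chain of a canonical `I`-stable
smooth formal arc, forced by group theory (`K` = pointwise fixer is p-closed, not a p-group, `I/K ↪
Aut κ⟦w⟧` p-closed; determinant and central-cyclic arguments) to be the REGULAR ALGEBRAIC curve
`Fix(C_K)`, which one blows up after separating its `G`-translates — the measure (max inertia order,
number of points attaining it) drops). The local algebra common to the surface point-step and the
threefold curve-step is registered as `stub_flagCore` = `stub_borelCore` generalised from `𝔪` to an
`I`-stable ideal `J` with `J ∩ 𝔪² ⊆ 𝔪J`, `dim J̄ ≤ 2`, `codim J̄ ≤ 1` (three characters instead of two,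
`(ḡ - 1)³ = 0`); the dimension-`≤ 2` assembly is rewired through its corollary `borelCore_of_flagCore`
(`J = 𝔪`), so the registered stubs are `stub_flagCore` (worker), `stub_phaseZeroHighDim` (dim 3: paper
theorem, Lean-XXL; dim ≥ 4: open-adjacent), `stub_pClosedWQNormal` (open).
-/

noncomputable section

open CategoryTheory AlgebraicGeometry TopologicalSpace IsLocalRing
open Literature.AlgebraicGeometry.Resolution Literature.AlgebraicGeometry.Ramification
open Summit.ResolutionOfSingularities.ResolutionOfSingularities.Theses.WildQuotients

set_option linter.dupNamespace false

namespace Summit.ResolutionOfSingularities.ResolutionOfSingularities.Cruxes.WildQuotientResolution.Lines.Sketch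

/-! ## Phase 0 in dimension `≤ 2`: the five classical stubs of skeleton v6 (lead c4)

They assemble (lead, v6b) into PhaseZeroModel for `topologicalKrullDim X′ ≤ 2`: `stub_isClosed_inertiaLocus`
+ `stub_npcCentre` give the finite reduced `G`-stable centre `Z = NPC(X′)` of closed points with
2-dimensional regular local rings; `exists_isBlowup` + `IsBlowup.liftAction` the equivariant model
`π : X♯ → X′` (regular by `IsBlowup.isRegularLocalRing_stalk_of_finite` / `isIso_compl`, integral, proper,
birational by `BlowupsIntegral` / `BlowupsProperProofs`); `stub_pointBlowupStalkData` + `stub_borelCore`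
(LANDED p145174; since v7 derived from the registered `stub_flagCore` as `borelCore_of_flagCore`)
give p-closed inertia over `Z` (off `Z` inertia only shrinks, `InertiaLe.stub_inertia_le`);
`stub_stableAffineCoverBlowup` gives Mumford's cover clause. -/

/-- STUB `stub_flagCore` (L, classical commutative algebra + finite group theory; LANDED p156726; skeleton v7,
lead c5 — GENERALISES the landed `stub_borelCore` (p145174) from the maximal ideal to an `I`-stable ideal
`J`, the form the dimension-3 CURVE step of Phase 0 consumes (`Lines/Sketch.md` cycle 6, Lemma 5), and
re-derives the surface case below (`borelCore_of_flagCore`, `J = 𝔪`)). **Inertia upstairs of a blow-up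
whose centre ideal `J` has `dim J̄ ≤ 2` and `codim_V J̄ ≤ 1` is p-closed** (the "flag argument": the
image of inertia in `GL(𝔪/𝔪²)` stabilises the FULL flag `ker φ̄ ⊂ J̄ ⊂ 𝔪/𝔪²`). Data: a Noetherian local
ring `(R, 𝔪, κ)` and a local domain `(S, 𝔫, κ₁)`, both residue fields of characteristic `p`; an
injective local homomorphism `ι : R → S`; an ideal `J ≤ 𝔪` with `J ∩ 𝔪² ⊆ 𝔪J` (automatic when `J` is
generated by part of a regular system of parameters — a regular centre through the point), whose image
`J̄` in `V = 𝔪/𝔪²` is spanned by (the classes of) two elements `j₁, j₂ ∈ J` (`hJgen`) and has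
codimension `≤ 1` (`hVgen`: `V = J̄ + κ v̄₀`); `J S = ι(t) S` principal upstairs, generated by the image
of some `t ∈ J` (the exceptional divisor); a finite group `I` acting on `R` faithfully (`τ` injective),
preserving `J` (`hJτ`), and on `S` residue-trivially (`τ₁ g s - s ∈ 𝔫`), compatibly
(`ι ∘ τ g = τ₁ g ∘ ι`). Conclusion: `I` has a normal Sylow `p`-subgroup.
Proof (= `Theorems/…StubBorelCore.lean` with one more character). (0) `τ` is residue-trivial on `R`
(`ι` local injective); `τ g` preserves `𝔪`, `𝔪²`, `J`, `𝔪J`. (1) `K := {g | ∀ r ∈ 𝔪, τ g r - r ∈ 𝔪²}`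
consists of p-elements (`BorelCore.exists_pow_eq_one_of_cotangentTrivial`). (2) For `r ∈ J` write
`ι r = e_r · ι t` (unique, `S` a domain, `t ≠ 0`; if `t = 0` then `J = 0`, skip to (4) with `χ = μ = 1`);
`χ g := e_{τ g t} mod 𝔫` is a character `I → κ₁ˣ` and `e_{τ g r} = τ₁ g (e_r) · c_g`. (3) `e` maps `𝔪J`
into `𝔫`, hence (by `hJ2`) `J ∩ 𝔪²` into `𝔫`; so `W̃ := {r ∈ J | e_r ∈ 𝔫}` is `τ`-stable, contains
`τ g r - r` for `r ∈ J`, `χ g = 1`, and its image `W` in `V` is a PROPER subspace of `J̄ = κ j̄₁ + κ j̄₂`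
(`t̄ ∉ W`), hence `W = κ w̄₀` for some `w₀ ∈ W̃` (possibly `w̄₀ = 0`); `μ g :=` the scalar of `τ g` on
`w̄₀` (`μ = 1` if `w̄₀ = 0`), a character `I → κˣ` with `τ g r - r ∈ 𝔪²` for `r ∈ W̃`, `μ g = 1`
(verbatim BorelCore step (4)). (4) NEW: `ν g :=` the scalar of `τ g` on `V/J̄ = κ v̄₀` (`τ g v₀ - n_g v₀ ∈
J + 𝔪²`, unique residue of `n_g` if `v̄₀ ∉ J̄`; `ν = 1` if `v̄₀ ∈ J̄`, i.e. `V = J̄`), a character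
`I → κˣ`, with `τ g r - r ∈ J + 𝔪²` for ALL `r ∈ 𝔪` when `ν g = 1` (write `r ≡ a v₀ + j`; use `hJτ`).
(5) `U := ker (χ, μ, ν) ⊴ I`. For `g ∈ U`, `r ∈ 𝔪`: `s₁ := τ g r - r ∈ J + 𝔪²`, `s₂ := τ g s₁ - s₁ ∈
W̃ + 𝔪²`, `τ g s₂ - s₂ ∈ 𝔪²`; hence (induction on `n`, generalising
`BorelCore.pow_apply_sub_sub_nsmul_mem`) `(τ g)ⁿ r - r - n s₁ - (n choose 2) s₂ ∈ 𝔪²`, and for `n = p²`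
both `p² ∈ 𝔪` and `p ∣ (p² choose 2)`: `g^{p²} ∈ K`, so `g` is a p-element: `U` is a p-group. (6) `I/U ↪
κ₁ˣ × κˣ × κˣ` has no element of order `p` (`BorelCore.units_eq_one_of_pow_char_eq_one`), so
`p ∤ [I : U]`; conclude by `HasNormalSylow.of_normal_of_not_dvd_index`. [folklore — the flag/Borel
argument; Serre1979 Ch. IV §2 Cor. 4 is the DVR shape] -/
theorem stub_flagCore (p : ℕ) [Fact p.Prime]
    {R S : Type*} [CommRing R] [IsLocalRing R] [IsNoetherianRing R]
    [CommRing S] [IsLocalRing S] [IsDomain S]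
    [CharP (ResidueField R) p] [CharP (ResidueField S) p]
    (ι : R →+* S) [IsLocalHom ι] (hι : Function.Injective ι)
    (J : Ideal R) (hJm : J ≤ maximalIdeal R)
    (hJ2 : J ⊓ maximalIdeal R ^ 2 ≤ maximalIdeal R * J)
    (hJgen : ∃ j₁ ∈ J, ∃ j₂ ∈ J, ∀ j ∈ J, ∃ a b : R, j - (a * j₁ + b * j₂) ∈ maximalIdeal R ^ 2)
    (hVgen : ∃ v₀ ∈ maximalIdeal R, ∀ r ∈ maximalIdeal R, ∃ a : R, ∃ j ∈ J,
      r - (a * v₀ + j) ∈ maximalIdeal R ^ 2)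
    (t : R) (ht : t ∈ J) (hgen : Ideal.map ι J = Ideal.span {ι t})
    {I : Type*} [Group I] [Finite I] (τ : I →* (R ≃+* R)) (τ₁ : I →* (S ≃+* S))
    (hτ : Function.Injective τ) (hJτ : ∀ (g : I), ∀ j ∈ J, τ g j ∈ J)
    (hcomp : ∀ (g : I) (r : R), ι (τ g r) = τ₁ g (ι r))
    (hres : ∀ (g : I) (s : S), τ₁ g s - s ∈ maximalIdeal S) :
    HasNormalSylow p I :=
  -- LANDED (wave 1 of lead c5, p156726): Theorems/WildQuotientsWildQuotientResolutionStubFlagCore.lean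
  Theorems.WildQuotientResolution.FlagCore.stub_flagCore p ι hι J hJm hJ2 hJgen hVgen t ht hgen τ τ₁ hτ
    hJτ hcomp hres

/-- Glue for `borelCore_of_flagCore`: if the cotangent space `𝔪/𝔪²` of a Noetherian local ring has
dimension `≤ 2`, the maximal ideal is spanned modulo `𝔪²` by two of its elements. [folklore] -/
theorem exists_two_span_of_finrank_cotangentSpace_le_two {R : Type*} [CommRing R] [IsLocalRing R]
    [IsNoetherianRing R] (hdim : Module.finrank (ResidueField R) (CotangentSpace R) ≤ 2) :
    ∃ j₁ ∈ maximalIdeal R, ∃ j₂ ∈ maximalIdeal R, ∀ j ∈ maximalIdeal R, ∃ a b : R,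
      j - (a * j₁ + b * j₂) ∈ maximalIdeal R ^ 2 := by
  classical
  set κ := ResidueField R
  set V := CotangentSpace R
  set m := maximalIdeal R
  -- a basis of `V` indexed by `Fin n`, `n ≤ 2`, padded to two vectors `f 0, f 1` spanning `V`
  let b := Module.finBasis κ V
  let f : Fin 2 → V := fun i =>
    if h : (i : ℕ) < Module.finrank κ V then b ⟨i, h⟩ else 0
  have hspan : ∀ v : V, ∃ c₀ c₁ : κ, v = c₀ • f 0 + c₁ • f 1 := by
    intro v
    have hv : v ∈ Submodule.span κ (Set.range b) := by rw [b.span_eq]; exact Submodule.mem_top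
    have hsub : Set.range b ⊆ {f 0, f 1} := by
      rintro _ ⟨i, rfl⟩
      have hi : (i : ℕ) < 2 := lt_of_lt_of_le i.2 hdim
      have key : f ⟨i, hi⟩ = b i := by
        simp only [f, dif_pos i.2]
      rcases Nat.lt_succ_iff.mp hi |>.eq_or_lt with h | h
      · right
        rw [Set.mem_singleton_iff, ← key]
        have h1 : (⟨(i : ℕ), hi⟩ : Fin 2) = 1 := Fin.ext (by simp [h])
        rw [h1]
      · left
        have h0 : (i : ℕ) = 0 := by omega
        rw [← key]
        have h0' : (⟨(i : ℕ), hi⟩ : Fin 2) = 0 := Fin.ext (by simp [h0])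
        rw [h0']
    have hv' := Submodule.span_mono hsub hv
    rw [Submodule.mem_span_pair] at hv'
    obtain ⟨c₀, c₁, hc⟩ := hv'
    exact ⟨c₀, c₁, hc.symm⟩
  obtain ⟨j₁, hj₁⟩ := m.toCotangent_surjective (f 0)
  obtain ⟨j₂, hj₂⟩ := m.toCotangent_surjective (f 1)
  refine ⟨j₁, j₁.2, j₂, j₂.2, fun j hj => ?_⟩
  obtain ⟨c₀, c₁, hc⟩ := hspan (m.toCotangent ⟨j, hj⟩)
  obtain ⟨a, rfl⟩ := residue_surjective c₀
  obtain ⟨b', rfl⟩ := residue_surjective c₁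
  refine ⟨a, b', ?_⟩
  have h : m.toCotangent (⟨j, hj⟩ - (a • j₁ + b' • j₂)) = 0 := by
    rw [map_sub, map_add, map_smul, map_smul, hj₁, hj₂, hc, sub_eq_zero]
    rfl
  rw [Ideal.toCotangent_eq_zero] at h
  simpa using h

/-- `stub_borelCore` (the surface case, LANDED p145174 as
`Theorems.WildQuotientResolution.BorelCore.stub_borelCore`) is the case `J = 𝔪` of `stub_flagCore`
(skeleton v7): `J̄ = V` has dimension `≤ 2`, codimension `0` (`v₀ = 0`), `𝔪 ∩ 𝔪² ⊆ 𝔪·𝔪`, and `𝔪` is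
stable under every ring automorphism. The dimension-`≤ 2` assembly below is wired through this
corollary, so that the registered local lemma is the one BOTH the point step (dim 2) and the curve step
(dim 3) use. [folklore] -/
theorem borelCore_of_flagCore (p : ℕ) [Fact p.Prime]
    {R S : Type*} [CommRing R] [IsLocalRing R] [IsNoetherianRing R]
    [CommRing S] [IsLocalRing S] [IsDomain S]
    [CharP (ResidueField R) p] [CharP (ResidueField S) p]
    (ι : R →+* S) [IsLocalHom ι] (hι : Function.Injective ι)
    (t : R) (ht : t ∈ maximalIdeal R)
    (hgen : Ideal.map ι (maximalIdeal R) = Ideal.span {ι t})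
    (hdim : Module.finrank (ResidueField R) (CotangentSpace R) ≤ 2)
    {I : Type*} [Group I] [Finite I] (τ : I →* (R ≃+* R)) (τ₁ : I →* (S ≃+* S))
    (hτ : Function.Injective τ) (hcomp : ∀ (g : I) (r : R), ι (τ g r) = τ₁ g (ι r))
    (hres : ∀ (g : I) (s : S), τ₁ g s - s ∈ maximalIdeal S) :
    HasNormalSylow p I := by
  obtain ⟨j₁, hj₁, j₂, hj₂, hspan⟩ := exists_two_span_of_finrank_cotangentSpace_le_two hdim
  refine stub_flagCore p ι hι (maximalIdeal R) le_rfl ?_ ⟨j₁, hj₁, j₂, hj₂, hspan⟩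
    ⟨0, zero_mem _, fun r hr => ⟨0, r, hr, by simp⟩⟩ t ht hgen τ τ₁ hτ
    (fun g j hj => Theorems.WildQuotientResolution.BorelCore.ringAut_apply_mem_maximalIdeal (τ g) hj)
    hcomp hres
  rw [pow_two]
  exact inf_le_right

/-- STUB `stub_isClosed_inertiaLocus` (S/M, classical; worker). **The locus where a given group
element is inert is closed**: for an action `ρ` of `G` on `X′` over `X₁` through the AFFINE (hence
separated) `q` (`ρ g ≫ q = q`) and `h ∈ G`, the set `{x | h ∈ I_x}` = `{x | h x = x, h trivial on κ(x)}`
(the tree's `inertiaSubgroup ρ x`: `Spec κ(x) → X′` is fixed by `ρ h`) is closed. Proof A: it is the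
underlying set of the equaliser of `(ρ h).hom` and `𝟙 X′`, a closed immersion because `X′` is separated
over `X₁` (Mathlib `isClosedImmersion_equalizer_ι_left` / `ext_of_fromSpecResidueField_eq` pattern:
`x` lies in the equaliser's range iff `fromSpecResidueField x ≫ ρ h = fromSpecResidueField x`, using
that a closed immersion induces isomorphisms on residue fields). Proof B: on an `h`-stable affine open
`O = q⁻¹V = Spec A` (they cover `X′`), with `α` the automorphism of `A` induced by `h`, the locus is
`V({α a - a | a ∈ A})` (the condition `α ≡ id mod 𝔭` forces `α 𝔭 = 𝔭`). [folklore; AbbesSaito2011 2.4] -/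
theorem stub_isClosed_inertiaLocus {X' X₁ : Scheme.{0}} (q : X' ⟶ X₁) [IsAffineHom q]
    {G : Type} [Group G] (ρ : G →* Aut X') (hρ : ∀ g : G, (ρ g).hom ≫ q = q) (h : G) :
    IsClosed {x : X' | h ∈ inertiaSubgroup ρ x} :=
  -- LANDED (wave 1, p146231): Theorems/WildQuotientsWildQuotientResolutionStubInertiaLocus.lean
  Theorems.WildQuotientResolution.InertiaLocus.stub_isClosed_inertiaLocus q ρ hρ h

/-- STUB `stub_npcCentre` (M, classical; worker). **On a regular `G`-surface the non-p-closed locus is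
a finite `G`-stable set of closed points.** Let `X′` be integral, regular, locally Noetherian AND
QUASI-COMPACT (v6a′: `[CompactSpace X']` is NECESSARY — the affine plane with infinitely many origins
under `GL₂(𝔽_p)` has infinitely many non-p-closed points; worker reply 2026-08-17), of
dimension `≤ 2`, affine over `X₁/k` (`char k = p`) through the `G`-invariant `q`, with `G` finite acting
FAITHFULLY, and assume each locus `{x | h ∈ I_x}` is closed (`stub_isClosed_inertiaLocus`). Then
`Z := NPC(X′) = {x | I_x has no normal Sylow p-subgroup}` is closed (a finite union over the
non-p-closed subgroups `H ≤ G` of the finite intersections `⋂_{h ∈ H} {x | h ∈ I_x}` — subgroups of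
p-closed groups are p-closed, `HasNormalSylow.subgroup`, and `H ≤ I_x` transfers along the isomorphism
`H ≃* H.subgroupOf I_x`), `G`-stable (`I_{g x} = g I_x g⁻¹`, `HasNormalSylow` is invariant under
`MulEquiv`: `HasNormalSylow.of_surjective`), consists of CLOSED points (the generic point has trivial
inertia, `PhaseZeroDimOne.inertiaSubgroup_genericPoint_eq_bot`; a point with DVR stalk — every
non-generic point with `dim 𝒪_{X′,x} ≤ 1` of the regular `X′`,
`isDiscreteValuationRing_of_isRegularLocalRing_of_ringKrullDim_eq_one`,
`Motives.…eq_genericPoint_of_ringKrullDim_stalk_eq_zero` — has p-closed inertia,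
`Ramification.hasNormalSylow_inertiaSubgroup_of_isIntegral` with `PhaseZeroDimOne.charP_stalk`; so
`dim 𝒪_{X′,z} = 2 = dim X′` on `Z` (`ringKrullDim_stalk_le_topologicalKrullDim`), and a point with a
proper specialisation has a stalk of smaller dimension than its specialisation,
`ringKrullDim_stalk_lt_of_specializes`), and is therefore FINITE (a closed subset of a Noetherian sober
space all of whose points are closed: each irreducible component is the closure of its generic point, a
closed point). [folklore; AbbesSaito2011 §2] -/
theorem stub_npcCentre (p : ℕ) [Fact p.Prime] {k : Type} [Field k] [CharP k p]
    {X' X₁ : Scheme.{0}} (f : X₁ ⟶ Spec (.of k)) (q : X' ⟶ X₁) [IsAffineHom q]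
    {G : Type} [Group G] [Finite G] (ρ : G →* Aut X') (hfaith : Function.Injective ρ)
    (hρ : ∀ g : G, (ρ g).hom ≫ q = q) [IsIntegral X'] [IsLocallyNoetherian X'] [CompactSpace X']
    (hreg : Scheme.IsRegular X') (hdim : topologicalKrullDim X' ≤ 2)
    (hcl : ∀ h : G, IsClosed {x : X' | h ∈ inertiaSubgroup ρ x}) :
    ∃ Z : Set X', (∀ x : X', x ∈ Z ↔ ¬ HasNormalSylow p (inertiaSubgroup ρ x)) ∧
      IsClosed Z ∧ Z.Finite ∧ (∀ z ∈ Z, IsClosed ({z} : Set X')) ∧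
      (∀ g : G, (ρ g).hom.base ⁻¹' Z = Z) ∧
      (∀ z ∈ Z, ringKrullDim (X'.presheaf.stalk z) = 2) :=
  -- LANDED (wave 1, p152192): Theorems/WildQuotientsWildQuotientResolutionStubNpcCentre.lean
  Theorems.WildQuotientResolution.NpcCentre.stub_npcCentre p f q ρ hfaith hρ hreg hdim hcl

/-- STUB `stub_pointBlowupStalkData` (M/L, classical scheme plumbing; worker). **The local data of an
equivariant blow-up of finitely many closed points, at a point over the centre** — exactly the
hypotheses of `stub_borelCore`. Let `π : X♯ → X′` be a blowing up (`IsBlowup`) of the integral locally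
Noetherian `X′` along the reduced ideal `𝓘_Z` (`Scheme.IdealSheafData.vanishingIdeal`) of a finite
closed set `Z` of closed points, `G` acting on `X′` faithfully over the affine `q` and on `X♯` with `π`
equivariant, `x ∈ X♯` over `z = π x ∈ Z`, `I = I_x ≤ G` its inertia group. Then with `R = 𝒪_{X′,z}`,
`S = 𝒪_{X♯,x}`, `ι = π^♯_x`: (i) `I` acts on `R` and on `S` by ring automorphisms `τ`, `τ₁` (as in
`Ramification.hasNormalSylow_inertiaSubgroup_of_stalk`: `a_g = stalkSpecializes ≫ stalkMap`, the
elements of `I_x` fix `x`, and fix `z` because `I_x ≤ I_z`, `InertiaLe.stub_inertia_le`), (ii) `τ` is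
injective (`Ramification.eq_one_of_fromSpecStalk_comp_eq`: faithful on an integral scheme over the
separated `q`), (iii) compatibly with `ι` (stalk form of `ρ♯ g ≫ π = π ≫ ρ g`, `Scheme.Hom.stalkMap_comp`,
`stalkMap_congr_hom`), (iv) `τ₁` is residue-trivial (definition of `I_x`), (v) `𝔪_R S = (ι t)` for some
`t ∈ 𝔪_R`: the stalk of `𝓘_Z` at `z` is `𝔪_R` (`stalkIdeal_vanishingIdeal_of_finite`), and by
`IsBlowup.exists_reesChart_stalk` `S` is a localisation of a chart `𝒪_{X′,z}[𝔪/c_j]` in which `𝔪`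
generates `(c_j)` (`map_reesChartBase_eq`), so `t = c_j`; (vi) `ι` is injective
(`IsBlowup.stalkMap_injective`). [folklore; StacksProject Tag 0804] -/
theorem stub_pointBlowupStalkData {X' X₁ : Scheme.{0}} (q : X' ⟶ X₁) [IsAffineHom q]
    {G : Type} [Group G] [Finite G] (ρ : G →* Aut X') (hfaith : Function.Injective ρ)
    (hρ : ∀ g : G, (ρ g).hom ≫ q = q) [IsIntegral X'] [IsLocallyNoetherian X']
    {Z : Set X'} (hZc : IsClosed Z) (hZf : Z.Finite) (hZpt : ∀ z ∈ Z, IsClosed ({z} : Set X'))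
    {Xs : Scheme.{0}} {π : Xs ⟶ X'}
    (hπ : IsBlowup π (Scheme.IdealSheafData.vanishingIdeal ⟨Z, hZc⟩)) [IsIntegral Xs]
    (ρs : G →* Aut Xs) (hequiv : ∀ g : G, (ρs g).hom ≫ π = π ≫ (ρ g).hom)
    (x : Xs) (hx : π.base x ∈ Z) :
    ∃ (τ : inertiaSubgroup ρs x →*
          (X'.presheaf.stalk (π.base x) ≃+* X'.presheaf.stalk (π.base x)))
      (τ₁ : inertiaSubgroup ρs x →* (Xs.presheaf.stalk x ≃+* Xs.presheaf.stalk x))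
      (t : X'.presheaf.stalk (π.base x)),
      Function.Injective τ ∧
      (∀ (g : inertiaSubgroup ρs x) (r : X'.presheaf.stalk (π.base x)),
        (π.stalkMap x).hom (τ g r) = τ₁ g ((π.stalkMap x).hom r)) ∧
      (∀ (g : inertiaSubgroup ρs x) (s : Xs.presheaf.stalk x),
        τ₁ g s - s ∈ maximalIdeal (Xs.presheaf.stalk x)) ∧
      t ∈ maximalIdeal (X'.presheaf.stalk (π.base x)) ∧
      Ideal.map (π.stalkMap x).hom (maximalIdeal (X'.presheaf.stalk (π.base x))) =
        Ideal.span {(π.stalkMap x).hom t} ∧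
      Function.Injective (π.stalkMap x).hom :=
  -- LANDED (wave 1, p148991): Theorems/WildQuotientsWildQuotientResolutionStubPointBlowupStalkData.lean
  Theorems.WildQuotientResolution.PointBlowupStalkData.stub_pointBlowupStalkData q ρ hfaith hρ hZc hZf
    hZpt hπ ρs hequiv x hx

/-- STUB `stub_stableAffineCoverBlowup` (M, classical; worker). **Mumford's hypothesis survives an
equivariant blow-up**: let `G` (finite) act on the separated locally Noetherian `X′` over `X₁` through
the AFFINE `q`, let `π : X♯ → X′` be a blowing up along any ideal sheaf `J` carrying an action `ρ♯`
with `π` equivariant. Then every point of `X♯` has a `G`-stable affine open neighbourhood. Proof: `x ∈ X♯`,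
`O ∋ π x` a `G`-stable affine open of `X′` (`PClosedCase.exists_isAffineOpen_stable`: `q⁻¹` of an
affine of `X₁`); `π⁻¹O → O` is a blowing up of the affine `O` (`IsBlowup.restrict`), hence isomorphic
over `O` to `Proj` of the Rees algebra (`affineBlowup.isBlowup`, `IsBlowup.unique`, transport as in
`RegularBlowup.IsBlowup.isRegular_of_isAffine_of_isQuasiRegular`); the finite orbit `G·x ⊆ π⁻¹O` lies in
an affine basic open `D₊(F)` (graded prime avoidance, `Motives.GradedPrimeAvoidance.exists_form_basicOpen`
with `r = 𝟙`, `Proj.isAffineOpen_basicOpen`), giving an affine open `U ⊆ X♯` containing the orbit; then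
`⋂_g (ρ♯ g)⁻¹ U` is `G`-stable, contains `x`, and is affine as a finite intersection of affine opens of
the separated `X♯` (`IsAffineOpen.iInf`; `X♯` is separated: `π` proper by `IsBlowup.isProper`, `X′`
separated) — the pattern of `Theorems.exists_stableAffineOpens_mem`
(`WildQuotientsGaloisQuotientStableCover.lean`). [cite: MumfordAV1970 §7 Thm. p. 66 (proof)] -/
theorem stub_stableAffineCoverBlowup {X' X₁ : Scheme.{0}} (q : X' ⟶ X₁) [IsAffineHom q]
    [X'.IsSeparated] [IsLocallyNoetherian X']
    {G : Type} [Group G] [Finite G] (ρ : G →* Aut X') (hρ : ∀ g : G, (ρ g).hom ≫ q = q)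
    {Xs : Scheme.{0}} {π : Xs ⟶ X'} {J : X'.IdealSheafData} (hπ : IsBlowup π J)
    (ρs : G →* Aut Xs) (hequiv : ∀ g : G, (ρs g).hom ≫ π = π ≫ (ρ g).hom) (x : Xs) :
    ∃ U : Xs.Opens, IsAffineOpen U ∧ x ∈ U ∧ ∀ g : G, (ρs g).hom ⁻¹ᵁ U = U :=
  -- LANDED (wave 1, p151564): Theorems/WildQuotientsWildQuotientResolutionStubStableAffineCoverBlowup.lean
  Theorems.WildQuotientResolution.StableAffineCoverBlowup.stub_stableAffineCoverBlowup q ρ hρ hπ ρs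
    hequiv x

/-! ## Phase 0 in dimension `≤ 2`: the assembly (lead c4, skeleton v6b) -/

/-- p-closedness passes to smaller subgroups of the ambient group: if `H ≤ K ≤ G` and `K` has a
normal Sylow `p`-subgroup then so has `H` (`H ≃* H.subgroupOf K`, `HasNormalSylow.subgroup`,
`HasNormalSylow.of_surjective`). [folklore] -/
theorem hasNormalSylow_of_le {p : ℕ} [Fact p.Prime] {G : Type*} [Group G] [Finite G]
    {H K : Subgroup G} (hHK : H ≤ K) (hK : HasNormalSylow p K) : HasNormalSylow p H :=
  (hK.subgroup (H.subgroupOf K)).of_surjective (Subgroup.subgroupOfEquivOfLe hHK).toMonoidHom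
    (Subgroup.subgroupOfEquivOfLe hHK).surjective

/-- Residue fields of the local rings of a scheme over a field `k` of characteristic `p` have
characteristic `p` (`k → Γ(X, ⊤) → 𝒪_{X,x} → κ(x)` is a ring map out of a field). [folklore] -/
theorem charP_residueField (p : ℕ) {k : Type} [Field k] [CharP k p] {X : Scheme.{0}}
    (g : X ⟶ Spec (.of k)) (x : X) : CharP (ResidueField (X.presheaf.stalk x)) p :=
  (((IsLocalRing.residue (X.presheaf.stalk x)).comp ((X.presheaf.germ ⊤ x trivial).hom.comp
    ((g.appTop).hom.comp (Scheme.ΓSpecIso (.of k)).inv.hom))).charP_iff_charP p).mp inferInstance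

/-- **PhaseZeroModel in dimension `≤ 2` — Phase 0 on a regular `G`-surface is ONE equivariant
blow-up** (lead c4, skeleton v6b; assembled from the five classical stubs and the tree's blow-up
library). For the crux data with `G` acting FAITHFULLY on the regular integral `X′` of dimension
`≤ 2`: let `Z = NPC(X′)` be the finite closed `G`-stable set of closed points with non-p-closed
inertia (`stub_isClosed_inertiaLocus`, `stub_npcCentre`); blow `X′` up along the reduced ideal
`𝓘_Z` (`exists_isBlowup`) and lift the action (`IsBlowup.liftAction`,
`vanishingIdeal_comap_eq_of_action`). The model `π : X♯ → X′` is proper (`IsBlowup.isProper`),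
birational and integral (`IsBlowup.isBirational'`, `IsBlowup.isIntegral`: `𝓘_Z ≠ 0` as the generic
point has trivial inertia), regular (over `Z` by `IsBlowup.isRegularLocalRing_stalk_of_finite`, off
`Z` because `π` is an isomorphism there, `IsBlowup.isIso_compl`), every inertia group is p-closed
(over `Z`: `stub_pointBlowupStalkData` feeds `stub_borelCore` — embedding dimension
`dim 𝒪_{X′,z} = 2`; off `Z`: inertia only shrinks, `InertiaLe.stub_inertia_le`), and `X♯` has a
`G`-stable affine cover (`stub_stableAffineCoverBlowup`). [folklore — the Borel argument] -/
theorem phaseZero_dimLE_two (p : ℕ) (hp : p.Prime) (k : Type) [Field k] [CharP k p]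
    (X' X₁ : Scheme.{0}) (f : X₁ ⟶ Spec (.of k)) (q : X' ⟶ X₁) (G : Type) [Group G] [Finite G]
    (ρ : G →* Aut X') (hfaith : Function.Injective ρ)
    [IsSeparated f] [LocallyOfFiniteType f] [QuasiCompact f] [IsIntegral X']
    (hreg : Scheme.IsRegular X') [IsFinite q] (hρ : ∀ g : G, (ρ g).hom ≫ q = q)
    (hdim : topologicalKrullDim X' ≤ 2) :
    ∃ (Xs : Scheme.{0}) (π : Xs ⟶ X') (ρs : G →* Aut Xs), IsProper π ∧ IsBirational π ∧
      IsIntegral Xs ∧ Scheme.IsRegular Xs ∧ (∀ g : G, (ρs g).hom ≫ π = π ≫ (ρ g).hom) ∧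
      (∀ x : Xs, HasNormalSylow p (inertiaSubgroup ρs x)) ∧
      ∀ x : Xs, ∃ U : Xs.Opens, IsAffineOpen U ∧ x ∈ U ∧ ∀ g : G, (ρs g).hom ⁻¹ᵁ U = U := by
  haveI : Fact p.Prime := ⟨hp⟩
  -- `X′` is Noetherian and separated (finite over the separated finite-type `X₁/k`)
  haveI : IsLocallyNoetherian X' := LocallyOfFiniteType.isLocallyNoetherian (q ≫ f)
  haveI : CompactSpace X' := QuasiCompact.compactSpace_of_compactSpace (q ≫ f)
  haveI : X'.IsSeparated := Scheme.isSeparated_of_isSeparated_over (q ≫ f)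
  -- the centre `Z = NPC(X′)`
  have hcl : ∀ h : G, IsClosed {x : X' | h ∈ inertiaSubgroup ρ x} := fun h =>
    stub_isClosed_inertiaLocus q ρ hρ h
  obtain ⟨Z, hZiff, hZc, hZf, hZpt, hZstab, hZdim⟩ :=
    stub_npcCentre p f q ρ hfaith hρ hreg hdim hcl
  -- the blow-up and the lifted action
  obtain ⟨Xs, π, hπ⟩ := exists_isBlowup X' (Scheme.IdealSheafData.vanishingIdeal ⟨Z, hZc⟩)
  have hJG : ∀ g : G, (Scheme.IdealSheafData.vanishingIdeal (⟨Z, hZc⟩ : Closeds X')).comap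
      (ρ g).hom = Scheme.IdealSheafData.vanishingIdeal ⟨Z, hZc⟩ :=
    vanishingIdeal_comap_eq_of_action ρ ⟨Z, hZc⟩ hZstab
  let ρs : G →* Aut Xs := hπ.liftAction ρ hJG
  have hequiv : ∀ g : G, (ρs g).hom ≫ π = π ≫ (ρ g).hom := hπ.liftAction_hom_comp ρ hJG
  -- the generic point is not in `Z`, so `𝓘_Z ≠ 0`
  have hη : genericPoint X' ∉ Z := by
    rw [hZiff, not_not, Theorems.WildQuotientResolution.PhaseZeroDimOne.inertiaSubgroup_genericPoint_eq_bot
      q ρ hρ hfaith]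
    exact HasNormalSylow.of_isPGroup IsPGroup.of_bot
  have hJne : Scheme.IdealSheafData.vanishingIdeal (⟨Z, hZc⟩ : Closeds X') ≠ ⊥ := by
    intro h
    have hsupp : Z = Set.univ := by
      have := congrArg (fun I : X'.IdealSheafData => ((I.support : Closeds X') : Set X')) h
      simpa using this
    exact hη (hsupp ▸ Set.mem_univ _)
  haveI hXs : IsIntegral Xs := hπ.isIntegral hJne
  haveI hπp : IsProper π := hπ.isProper
  have hbir : IsBirational π := hπ.isBirational' hJne
  -- regularity of `X♯`
  have hRo : IsOpen (Scheme.regularLocus X') := by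
    have : Scheme.regularLocus X' = Set.univ := Set.eq_univ_of_forall fun x => hreg x
    rw [this]
    exact isOpen_univ
  have hXsreg : Scheme.IsRegular Xs := by
    intro x
    by_cases hx : π.base x ∈ Z
    · exact IsBlowup.isRegularLocalRing_stalk_of_finite hRo hZc hZf hZpt (fun z _ => hreg z) hπ hx
    · set W₀ : X'.Opens := ⟨((Scheme.IdealSheafData.vanishingIdeal (⟨Z, hZc⟩ : Closeds X')).support :
          Set X')ᶜ, (Scheme.IdealSheafData.vanishingIdeal (⟨Z, hZc⟩ : Closeds X')).support.isClosed.isOpen_compl⟩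
        with hW₀
      haveI : IsIso (π ∣_ W₀) := hπ.isIso_compl
      have hxW : x ∈ π ⁻¹ᵁ W₀ := by
        change π.base x ∈ ((Scheme.IdealSheafData.vanishingIdeal (⟨Z, hZc⟩ : Closeds X')).support :
          Set X')ᶜ
        rw [Scheme.IdealSheafData.coe_support_vanishingIdeal]
        exact hx
      have hregW : Scheme.IsRegular (↑(π ⁻¹ᵁ W₀) : Scheme.{0}) :=
        Scheme.IsRegular.of_isOpenImmersion (π ∣_ W₀ ≫ W₀.ι) hreg
      haveI := hregW ⟨x, hxW⟩
      exact IsRegularLocalRing.of_ringEquiv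
        (asIso ((π ⁻¹ᵁ W₀).ι.stalkMap ⟨x, hxW⟩)).commRingCatIsoToRingEquiv.symm
  refine ⟨Xs, π, ρs, hπp, hbir, hXs, hXsreg, hequiv, fun x => ?_, fun x => ?_⟩
  · -- inertia groups are p-closed
    by_cases hx : π.base x ∈ Z
    · obtain ⟨τ, τ₁, t, hτ, hcomp, hres, ht, hgen, hι⟩ :=
        stub_pointBlowupStalkData q ρ hfaith hρ hZc hZf hZpt hπ ρs hequiv x hx
      haveI := hreg (π.base x)
      haveI : CharP (ResidueField (X'.presheaf.stalk (π.base x))) p :=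
        charP_residueField p (q ≫ f) (π.base x)
      haveI : CharP (ResidueField (Xs.presheaf.stalk x)) p := charP_residueField p (π ≫ q ≫ f) x
      have hfin : Module.finrank (ResidueField (X'.presheaf.stalk (π.base x)))
          (CotangentSpace (X'.presheaf.stalk (π.base x))) ≤ 2 := by
        have h2 := (IsRegularLocalRing.iff_finrank_cotangentSpace (X'.presheaf.stalk (π.base x))).mp
          inferInstance
        rw [hZdim _ hx] at h2
        have h2' : (Module.finrank (ResidueField (X'.presheaf.stalk (π.base x)))
            (CotangentSpace (X'.presheaf.stalk (π.base x))) : WithBot ℕ∞) = ((2 : ℕ) : WithBot ℕ∞) := h2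
        exact (Nat.cast_injective (R := WithBot ℕ∞) h2').le
      exact borelCore_of_flagCore p (π.stalkMap x).hom hι t ht hgen hfin τ τ₁ hτ hcomp hres
    · have hpx : HasNormalSylow p (inertiaSubgroup ρ (π.base x)) := by
        by_contra hc
        exact hx ((hZiff _).mpr hc)
      exact hasNormalSylow_of_le
        (Theorems.WildQuotientResolution.InertiaLe.stub_inertia_le ρs ρ π hequiv x) hpx
  · -- Mumford's cover clause
    exact stub_stableAffineCoverBlowup q ρ hρ hπ ρs hequiv x

/-! ## The engine (landed; consumed by the intended Phase-0 witness, not by the composition)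

The three engine lemmas of the card are THEOREMS in the tree (wave 1 of lead c0) and are therefore no
longer stubs of this skeleton (v5): `Theorems.WildQuotientResolution.LocalDrop.stub_localDrop`
(p130134 — p-power-order elements stabilising a line fix it; `W^Π = 0` forces a strict drop),
`Theorems.WildQuotientResolution.NormalSylow.stub_hasNormalSylow_iff` (p130224 — p-closed iff the
p-elements generate a p-group), `Theorems.WildQuotientResolution.InertiaLe.stub_inertia_le` (p130271 —
inertia shrinks along equivariant morphisms). -/

/-! ## Phase 0 (Sylow separation) and the transfer -/

/-- STUB `stub_phaseZeroHighDim` (XL, OPEN-ADJACENT — the honest remaining Phase-0 problem of skeleton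
v6/v7): PhaseZeroModel (the v5 `stub_phaseZero` statement verbatim) for `dim X′ ≥ 3`
(`¬ topologicalKrullDim X′ ≤ 2`). Status by dimension (v7): **`dim X′ = 3` is a THEOREM on paper**
(`Lines/Sketch.md` cycle 6 — curve phase + point phase with the canonical-arc termination; Lean-XXL:
needs `stub_flagCore`, curve-blow-up stalk data, "no NPC curves in an exceptional `ℙ²`", equivariant
embedded resolution of curve configurations by point blow-ups, the free-point/formal-branch
correspondence, regularity of tame fixed loci, finite residue-trivial subgroups of `Aut κ⟦w⟧`);
`dim X′ ≥ 4` open-adjacent (no centre through an NPC point has both a `≤ 2`-dimensional conormal and a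
`≤ 1`-dimensional cotangent representation, so the one-step flag argument never applies, and a subgroup of
`GL₂ × B₂` with p-closed projections need not be p-closed; from `dim X′ ≥ 6` it contains weak embedded
resolution of threefolds, `Lines/Sketch.md` cycle 1, the `A₅`-cocycle family).
[cite: card p-closure-sylow-separation; difficulty: open-problem-adjacent] -/
theorem stub_phaseZeroHighDim (p : ℕ) (hp : p.Prime) (k : Type) [Field k] [CharP k p]
    (X' X₁ : Scheme.{0}) (f : X₁ ⟶ Spec (.of k)) (q : X' ⟶ X₁) (G : Type) [Group G] [Finite G]
    (ρ : G →* Aut X') (hfaith : Function.Injective ρ)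
    [IsSeparated f] [LocallyOfFiniteType f] [QuasiCompact f] [IsIntegral X']
    (hreg : Scheme.IsRegular X') [IsFinite q] (hρ : ∀ g : G, (ρ g).hom ≫ q = q)
    (hdim : ¬ topologicalKrullDim X' ≤ 2) :
    ∃ (Xs : Scheme.{0}) (π : Xs ⟶ X') (ρs : G →* Aut Xs), IsProper π ∧ IsBirational π ∧
      IsIntegral Xs ∧ Scheme.IsRegular Xs ∧ (∀ g : G, (ρs g).hom ≫ π = π ≫ (ρ g).hom) ∧
      (∀ x : Xs, HasNormalSylow p (inertiaSubgroup ρs x)) ∧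
      ∀ x : Xs, ∃ U : Xs.Opens, IsAffineOpen U ∧ x ∈ U ∧ ∀ g : G, (ρs g).hom ⁻¹ᵁ U = U := by
  sorry

/-- STUB `stub_phaseZero` (XL, OPEN-ADJACENT; card `p-closure-sylow-separation`, "PClosureAfterBlowup") —
**Phase 0, Sylow separation = PhaseZeroModel** (skeleton v5: the three engine lemmas it consumes —
`stub_localDrop`, `stub_hasNormalSylow_iff`, `stub_inertia_le` — are theorems and no longer ride as
hypotheses; faithfulness stays: without it the statement is FALSE,
`Theorems.WildQuotientResolution.PhaseZeroFaithful.not_stub_phaseZero_v3`, the trivial action of `S₃` on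
`Spec 𝔽₂`, `p = 2`). For a prime `p`, a field `k` of characteristic `p`, a regular integral `X′` finite
over a separated finite-type `X₁/k` and a finite group `G` acting FAITHFULLY on `X′` over `X₁`, there
is a `G`-EQUIVARIANT proper birational `π : X♯ → X′` with `X♯` regular and integral, carrying an action
`ρ♯` with `ρ♯(g) ≫ π = π ≫ ρ(g)`, such that EVERY inertia group `I_x ⊆ G` (`x ∈ X♯`; AS2011 2.4) has a
normal Sylow `p`-subgroup, and `X♯` is covered by `G`-STABLE AFFINE opens (Mumford's hypothesis, so
that `X♯/G` exists as a scheme; automatic for `π` projective). Intended witness: the composition of the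
blow-ups, in decreasing order of `|Π(x)|` (`Π(x) = ⟨p-power-order elements of I_x⟩`), of the reduced
fixed loci `Fix(R(Π(x)))_red` of the p-closed residuals — regular `G`-stable centres when `R` is a
`p′`-group, embedded-regularised first when `R` is wild (known for centres of dimension `≤ 2`, i.e.
`dim X′ ≤ 4`; OPEN beyond: on the `A₅`-cocycle family Phase 0 ⊇ weak embedded resolution of a
hypersurface two dimensions down, `Lines/Sketch.md` cycle 1) — over which `|Π|` drops strictly at every
exceptional point by `stub_localDrop`, never rises elsewhere by `stub_inertia_le`, and is p-closed
exactly when `Π` is a `p`-group by `stub_hasNormalSylow_iff`. Known slices (landed): `dim X′ ≤ 1`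
(`PhaseZeroDimOne`), `G` p-closed (`PhaseZeroPClosed`, identity model).
[cite: card p-closure-sylow-separation; AbbesSaito2011 Prop. 2.22 for the normal (non-regular)
analogue downstairs; MumfordAV1970 §7 Thm. p. 66 for the cover clause] -/
theorem stub_phaseZero (p : ℕ) (hp : p.Prime) (k : Type) [Field k] [CharP k p] (X' X₁ : Scheme.{0})
    (f : X₁ ⟶ Spec (.of k)) (q : X' ⟶ X₁) (G : Type) [Group G] [Finite G] (ρ : G →* Aut X')
    (hfaith : Function.Injective ρ)
    [IsSeparated f] [LocallyOfFiniteType f] [QuasiCompact f] [IsIntegral X']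
    (hreg : Scheme.IsRegular X') [IsFinite q] (hρ : ∀ g : G, (ρ g).hom ≫ q = q) :
    ∃ (Xs : Scheme.{0}) (π : Xs ⟶ X') (ρs : G →* Aut Xs), IsProper π ∧ IsBirational π ∧
      IsIntegral Xs ∧ Scheme.IsRegular Xs ∧ (∀ g : G, (ρs g).hom ≫ π = π ≫ (ρ g).hom) ∧
      (∀ x : Xs, HasNormalSylow p (inertiaSubgroup ρs x)) ∧
      ∀ x : Xs, ∃ U : Xs.Opens, IsAffineOpen U ∧ x ∈ U ∧ ∀ g : G, (ρs g).hom ⁻¹ᵁ U = U := by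
  -- v6b: dimension split — `dim X′ ≤ 2` is the assembled one-blow-up theorem, the rest is the
  -- registered open-adjacent stub `stub_phaseZeroHighDim`
  by_cases hdim : topologicalKrullDim X' ≤ 2
  · exact phaseZero_dimLE_two p hp k X' X₁ f q G ρ hfaith hreg hρ hdim
  · exact stub_phaseZeroHighDim p hp k X' X₁ f q G ρ hfaith hreg hρ hdim

/-! ## The quotient glue (classical) and the p-closed sub-problem (RESHAPE v5, lead c3) -/

/-- STUB `stub_quotientModelNormal` (L, classical — SGA1 V §1–2; LANDED wave 3, p141366; skeleton v5 = the LANDED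
`stub_quotientModel` (p138081: `Literature.AlgebraicGeometry.RelativeSpec.FiniteGroupQuotientGluing/
GluedProperties/GenericEtale/Universal`, `…FreeQuotientEtale`) with TWO more conjuncts). For the crux
data with FAITHFUL `ρ` and a `G`-equivariant proper birational integral NORMAL model `π : X♯ → X′`
with a `G`-stable affine cover: the quotient `Y₁ := X♯/G` over `k` — separated, locally of finite
type, quasi-compact, integral, and NORMAL (new: its local rings are localisations of rings of
invariants `Γ(O ∩ (π ≫ q)⁻¹U)^G` of integrally closed domains, `O` a stable affine, `U ⊆ X₁` affine;
`RelativeSpec.isIntegrallyClosed_fixedPoints_subring`, `Motives.isIntegrallyClosed_stalk_Spec`) — with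
the lifted action FAITHFUL (new as a conjunct, proved inside p138081: `ρ♯ g = 1 ⇒ π ≫ ρ g = π ⇒
ρ g = 1`, `π` dominant onto the reduced separated `X′`), `q♯ : X♯ → Y₁` finite, surjective,
`G`-invariant, fibres the `G`-orbits, étale over a dense open; the induced `r : Y₁ → X₁` with
`q♯ ≫ r = π ≫ q` and `r ≫ f = g`, proper; and a dense open `W ⊆ X₁` over which `r` is finite, étale
and bijective on points. [folklore; SGA1 Exp. V §1–2; MumfordAV1970 §7] -/
theorem stub_quotientModelNormal (p : ℕ) (k : Type) [Field k] [CharP k p]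
    (X' X₁ : Scheme.{0}) (f : X₁ ⟶ Spec (.of k)) (q : X' ⟶ X₁) (G : Type) [Group G] [Finite G]
    (ρ : G →* Aut X') (hfaith : Function.Injective ρ)
    [IsSeparated f] [LocallyOfFiniteType f] [QuasiCompact f] [IsIntegral X₁] [IsIntegral X']
    [IsFinite q] (hsurj : Function.Surjective q.base)
    (hU : ∃ U : X₁.Opens, Dense (U : Set X₁) ∧ Etale (q ∣_ U))
    (hρ : ∀ g : G, (ρ g).hom ≫ q = q)
    (horb : ∀ x y : X', q.base x = q.base y → ∃ g : G, (ρ g).hom.base x = y)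
    (Xs : Scheme.{0}) (π : Xs ⟶ X') (ρs : G →* Aut Xs) [IsProper π] (hbir : IsBirational π)
    [IsIntegral Xs] (hXsnorm : ∀ x : Xs, IsIntegrallyClosed (Xs.presheaf.stalk x))
    (hequiv : ∀ g : G, (ρs g).hom ≫ π = π ≫ (ρ g).hom)
    (hcov : ∀ x : Xs, ∃ U : Xs.Opens, IsAffineOpen U ∧ x ∈ U ∧ ∀ g : G, (ρs g).hom ⁻¹ᵁ U = U) :
    ∃ (Y₁ : Scheme.{0}) (g : Y₁ ⟶ Spec (.of k)) (qs : Xs ⟶ Y₁) (r : Y₁ ⟶ X₁),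
      IsSeparated g ∧ LocallyOfFiniteType g ∧ QuasiCompact g ∧ IsIntegral Y₁ ∧
      (∀ y : Y₁, IsIntegrallyClosed (Y₁.presheaf.stalk y)) ∧ Function.Injective ρs ∧
      IsFinite qs ∧ Function.Surjective qs.base ∧
      (∃ V : Y₁.Opens, Dense (V : Set Y₁) ∧ Etale (qs ∣_ V)) ∧
      (∀ g : G, (ρs g).hom ≫ qs = qs) ∧
      (∀ x y : Xs, qs.base x = qs.base y → ∃ g : G, (ρs g).hom.base x = y) ∧
      IsProper r ∧ qs ≫ r = π ≫ q ∧ r ≫ f = g ∧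
      ∃ W : X₁.Opens, Dense (W : Set X₁) ∧ IsFinite (r ∣_ W) ∧ Etale (r ∣_ W) ∧
        Function.Bijective (r ∣_ W).base :=
  -- LANDED (wave 3, p141366): Theorems/WildQuotientsWildQuotientResolutionStubQuotientModelNormal.lean
  Theorems.WildQuotientResolution.QuotientModelNormal.stub_quotientModelNormal p k X' X₁ f q G ρ hfaith
    hsurj hU hρ horb Xs π ρs hbir hXsnorm hequiv hcov

/-- STUB `stub_birational_of_bijective` (M, classical — the lemma (L); LANDED p138276): over a field
`k`, let `r : Y₁ → X₁` be a morphism of integral schemes with `X₁` locally of finite type over `k`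
and of POSITIVE dimension; if over a dense open `W ⊆ X₁` the restriction `r ∣_ W` is finite, étale
and bijective on points, then `r` is birational (indeed `r ∣_ W` is an isomorphism: a finite étale
cover of degree `d` of an integral `k`-scheme of finite type and positive dimension which is
injective on points has `d = 1`). False in dimension `0` (`Spec L → Spec K`) and over a henselian
trait, whence the hypotheses. [folklore] -/
theorem stub_birational_of_bijective (k : Type) [Field k] {Y₁ X₁ : Scheme.{0}}
    (f : X₁ ⟶ Spec (.of k)) [LocallyOfFiniteType f] [IsIntegral X₁] [IsIntegral Y₁]
    (r : Y₁ ⟶ X₁) (hdim : ¬ topologicalKrullDim X₁ ≤ 0) (W : X₁.Opens)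
    (hW : Dense (W : Set X₁)) [IsFinite (r ∣_ W)] [Etale (r ∣_ W)]
    (hbij : Function.Bijective (r ∣_ W).base) : IsBirational r :=
  -- LANDED (wave 2, p138276): Theorems/WildQuotientsWildQuotientResolutionStubBirational.lean (+ RankOne p137789, Algebra p138056)
  Theorems.WildQuotientResolution.Birational.stub_birational_of_bijective k f r hdim W hW hbij

/-- STUB `stub_pClosedWQNormal` (OPEN — **the p-closed sub-problem for the quotient itself**, the
statement to PROMOTE; skeleton v5 sharpening of `stub_pClosedWQ`): the crux `WildQuotientResolution`
verbatim PLUS (i) every inertia group `I_x ⊆ G` (`x ∈ X′`, AS2011 2.4) has a normal Sylow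
`p`-subgroup (`I_x = P_x ⋊ C_x`), (ii) `ρ` is FAITHFUL, (iii) `X₁` is NORMAL (every local ring
integrally closed) and (iv) `dim X₁ > 0`. Under (ii)–(iv) the induced `X′/G → X₁` is finite and
birational onto a normal scheme, hence an isomorphism: `X₁` IS the quotient `X′/G` and `q` the quotient
map (no "up to normalization"). (ii)–(iv) cost nothing: `PClosedWQ ⇔ PClosedWQNormal` through the
landed glue (faithful WLOG `Negative.wqFaithful_iff`; dimension `0` is regular; the quotient model is
normal, `stub_quotientModelNormal`; lemma (L)). Implied by the summit; contains the route items
`CyclicWildQuotient` (stmt-15644, OPEN from dimension 4) and `TameQuotientResolution` (stmt-15645, over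
every field) — it is the part of the crux the route's central-series peeling (KiralyLutkebohmert as
terminal criterion) + Bergh–Rydh destackification are designed for, isolated from the non-p-closed
stabilisers (`SL₂(𝔽_q)`, `A_p`, `S_p`) that Phase 0 removes. [difficulty: open-problem] -/
theorem stub_pClosedWQNormal (p : ℕ) (hp : p.Prime) (k : Type) [Field k] [CharP k p]
    (X' X₁ : Scheme.{0}) (f : X₁ ⟶ Spec (.of k)) (q : X' ⟶ X₁) (G : Type) [Group G] [Finite G]
    (ρ : G →* Aut X') (hfaith : Function.Injective ρ) (hsep : IsSeparated f)
    (hft : LocallyOfFiniteType f) (hqc : QuasiCompact f) (hX₁ : IsIntegral X₁)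
    (hnorm : ∀ x : X₁, IsIntegrallyClosed (X₁.presheaf.stalk x))
    (hdim : ¬ topologicalKrullDim X₁ ≤ 0) (hX' : IsIntegral X')
    (hreg : Scheme.IsRegular X') (hq : IsFinite q) (hsurj : Function.Surjective q.base)
    (hU : ∃ U : X₁.Opens, Dense (U : Set X₁) ∧ Etale (q ∣_ U))
    (hρ : ∀ g : G, (ρ g).hom ≫ q = q)
    (horb : ∀ x y : X', q.base x = q.base y → ∃ g : G, (ρ g).hom.base x = y)
    (hNpS : ∀ x : X', HasNormalSylow p (inertiaSubgroup ρ x)) :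
    Scheme.HasResolution X₁ := by
  sorry

/-! ## The composition -/

/-- **The crux `WildQuotientResolution` from the stubs** (skeleton v5): reduce to a faithful action
(`Negative.wqFaithful_iff`); Phase 0 (`stub_phaseZero`) produces the equivariant regular model `X♯`
with p-closed inertia; if `dim X₁ ≤ 0` then `X₁` is regular; otherwise `stub_quotientModelNormal`
builds the NORMAL quotient `Y₁ = X♯/G → X₁` with faithful action upstairs (regular local rings are
integrally closed, `isIntegrallyClosed_of_isRegularLocalRing`), which is birational over `X₁` by
`stub_birational_of_bijective`, hence of the same positive dimension
(`GluedSplitDim.topologicalKrullDim_eq_of_isBirational`); `stub_pClosedWQNormal` resolves `Y₁`, and the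
resolution descends along the proper birational `Y₁ → X₁`. -/
theorem WildQuotientResolution_of : WildQuotientResolution := by
  refine Theorems.WildQuotientResolution.Negative.wqFaithful_iff.mp ?_
  intro p hp k _ _ X' X₁ f q G _ _ ρ hfaith hsep hft hqc hX₁ hX' hreg hq hsurj hU hρ horb
  haveI := hsep; haveI := hft; haveI := hqc; haveI := hX'; haveI := hq; haveI := hX₁
  obtain ⟨Xs, π, ρs, hπ, hbir, hXs, hXsreg, hequiv, hNpS, hcov⟩ :=
    stub_phaseZero p hp k X' X₁ f q G ρ hfaith hreg hρ
  haveI := hπ; haveI := hXs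
  by_cases hdim : topologicalKrullDim X₁ ≤ 0
  · exact (Scheme.IsRegular.of_topologicalKrullDim_le_zero hdim).hasResolution
  have hXsnorm : ∀ x : Xs, IsIntegrallyClosed (Xs.presheaf.stalk x) := fun x => by
    haveI := hXsreg x
    exact isIntegrallyClosed_of_isRegularLocalRing _
  obtain ⟨Y₁, g, qs, r, hsep₁, hft₁, hqc₁, hY₁, hnorm₁, hfaith₁, hqsfin, hqssurj, hV, hinv₁, horb₁,
      hr, -, hrg, W, hWd, hWfin, hWet, hWbij⟩ :=
    stub_quotientModelNormal p k X' X₁ f q G ρ hfaith hsurj hU hρ horb Xs π ρs hbir hXsnorm hequiv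
      hcov
  haveI := hY₁; haveI := hr; haveI := hWfin; haveI := hWet; haveI := hft₁
  have hbir₁ : IsBirational r := stub_birational_of_bijective k f r hdim W hWd hWbij
  haveI : LocallyOfFiniteType r := by
    have : LocallyOfFiniteType (r ≫ f) := by rw [hrg]; infer_instance
    exact locallyOfFiniteType_of_comp r f
  have hdim₁ : ¬ topologicalKrullDim Y₁ ≤ 0 := by
    rwa [Theorems.WildQuotientResolution.GluedSplitDim.topologicalKrullDim_eq_of_isBirational f r
      hbir₁]
  exact ComponentGluing.Scheme.HasResolution.of_isBirational r hbir₁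
    (stub_pClosedWQNormal p hp k Xs Y₁ g qs G ρs hfaith₁ hsep₁ hft₁ hqc₁ hY₁ hnorm₁ hdim₁ hXs hXsreg
      hqsfin hqssurj hV hinv₁ horb₁ hNpS)

end Summit.ResolutionOfSingularities.ResolutionOfSingularities.Cruxes.WildQuotientResolution.Lines.Sketch

end
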